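import Mathlib
import Summits.ResolutionOfSingularities.ResolutionOfSingularities.Theorems.HomologicalConductorPersistenceTraceCriterion
import Summits.ResolutionOfSingularities.ResolutionOfSingularities.Theorems.HomologicalConductorPersistenceCyclicTransferSyzygy
import HarnessLib

/-!
# Rung S-2 `PersistenceSurface` (stmt-ResolutionOfSingularities-19970) — the CONDUCTOR CEILING:
# `ca³(R) ⊆ 𝔠(R ⊂ C)` for every module-finite birational overring `C`

Route `ResolutionOfSingularities/HomologicalConductor`, chain W4.4b (cell `res-hironaka`), rung S-2
`PersistenceSurface` (stmt-ResolutionOfSingularities-19970), registered stub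
`stub_levelFourPersistenceNonnormalOrNonrational'` (L-other′, the class Σ8 = NON-NORMAL stage `0`), cell R5 / S-c
of res-L1-w44b-plan-1's S2-BRIEF («for `A ⊂ Ā` finite birational, `ca(A_𝔪) ⊆ 𝔠(A ⊂ Ā)` — heuristic»).  Seat
res-L1-w44b-lead-1 (gen 3).  `[OURS · L1 w44b]`; folklore commutative algebra; NOT a statement of the manuscript
under review (Hironaka 2017) and no statement of that manuscript is used; AI-written, weaker than expert review.

## Statement

Let `R` be a noetherian domain with fraction field `K`, and `M ⊆ K` an `R`-submodule with `1 ∈ M`, closed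
under multiplication and finitely generated — i.e. an intermediate ring `R ⊆ C := M ⊆ K` module-finite over `R`
(the normalisation of a non-normal surface germ is the case in point).  Let `𝔠 = (R :_R C) = {r | r·C ⊆ R}` be
the CONDUCTOR, an ideal of `R` (handed over as an `Ideal R` together with its defining property `h𝔠`; no
definition is introduced).  Then:

* `coe_mul_inv_le_coe` — the trace ideal of `𝔠` is `𝔠` itself: `𝔠·𝔠⁻¹ ⊆ 𝔠` in `FractionalIdeal R⁰ K`
  (`q𝔠 ⊆ R` is a `C`-submodule of `R`, hence inside `𝔠`);
* `conductor_ne_bot` — `𝔠 ≠ 0` (common denominator of the generators of `M`);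
* `exists_isSyzygy_two_dual` — over a noetherian ring the dual `N* = Hom_R(N, R)` of a finitely generated
  module is a SECOND SYZYGY module (kernel of the dual `(Rⁿ)* → (Rᵐ)*` of a finite presentation; tree
  `isSyzygy_two_ker`);
* `exists_linearEquiv_conductor_dual` — `𝔠 ≅ Hom_R(C, R)` (`c ↦ (γ ↦ cγ)`; a linear form `ψ` on `C` is
  multiplication by `ψ(1) ∈ 𝔠`, by clearing denominators in `K`), so `𝔠` is a second syzygy
  (`exists_isSyzygy_two_conductor`);
* **`cohomologyAnnihilatorOfDegree_three_le_conductor`** — `ca³(R) ⊆ 𝔠`: an element of `caˢ⁺¹(R)` lies in the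
  trace ideal `𝔞·𝔞⁻¹` of every nonzero ideal `𝔞` that is an `s`-th syzygy (tree
  `PersistenceTraceCriterion.mem_mul_inv_of_mem_cohomologyAnnihilatorOfDegree_of_isSyzygy`, res-L1-w44b-stub-2),
  applied to `𝔞 = 𝔠`, `s = 2`;
* `mem_conductor_of_mem_cohomologyAnnihilatorOfDegree_of_isSyzygy` — more generally `caˢ⁺¹(R) ⊆ 𝔠` whenever
  `𝔠` is an `s`-th syzygy (e.g. every `s`, for Gorenstein `R` of dimension `≤ 2`: then `ca(R) ⊆ 𝔠`,
  `cohomologyAnnihilator_le_conductor_of_forall_isSyzygy`);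
* `Subalgebra.coe_mul_mem_of_mem_cohomologyAnnihilatorOfDegree_three` — the same in the route's vocabulary:
  `B ≤ C` subalgebras of a field `K` with `Frac B = K` and `C` finitely generated as a `B`-module; every
  `x ∈ ca³(B)` multiplies `C` into `B`.

Level `3` is the meaningful one for surface germs (`ca² = 0` in depth `2`); the bound says that the centre
`ca(T₀)` of the first step of the canonical tower at a NON-NORMAL two-dimensional Gorenstein stage `T₀` (every
non-normal hypersurface or complete-intersection start) lies in the conductor of its normalisation — the first
clause of the planner's transitivity heuristic R5, now unconditional at level `3`.

References (mechanism only): S. B. Iyengar, R. Takahashi, IMRN 2016, Remark 2.13 [`IyengarTakahashi2014`];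
S. Dey, arXiv:2210.03891, Thm. 1.1 [`Dey2022TraceIdeal`]. All `[folklore]` at the level used here.
-/

-- single-problem summit: the doubled namespace component `ResolutionOfSingularities` is forced
set_option linter.dupNamespace false

noncomputable section

open CategoryTheory Literature.RingTheory.CohomologyAnnihilator
open scoped nonZeroDivisors

namespace Summit.ResolutionOfSingularities.ResolutionOfSingularities.Theorems.HomologicalConductor.PersistenceConductorCeiling

open Summit.ResolutionOfSingularities.ResolutionOfSingularities.Theorems.HomologicalConductor.PersistenceTraceCriterion
  (mem_mul_inv_of_mem_cohomologyAnnihilatorOfDegree_of_isSyzygy)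
open Summit.ResolutionOfSingularities.ResolutionOfSingularities.Theorems.HomologicalConductor.PersistenceCyclicTransferSyzygy
  (isSyzygy_two_ker)

universe u

variable {R : Type u} [CommRing R] [IsDomain R] {K : Type u} [Field K] [Algebra R K] [IsFractionRing R K]

/-! ## The conductor of an intermediate ring `R ⊆ C ⊆ K` -/

omit [IsDomain R] [IsFractionRing R K] in
/-- If `r ∈ 𝔠` and `m ∈ C` then `r·m` is (the image of) an element of `𝔠` again: `𝔠` is a `C`-ideal.
[folklore] -/
theorem exists_mem_conductor_eq_mul (M : Submodule R K) (hMmul : ∀ a ∈ M, ∀ b ∈ M, a * b ∈ M)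
    (𝔠 : Ideal R) (h𝔠 : ∀ r : R, r ∈ 𝔠 ↔ ∀ m ∈ M, ∃ r' : R, algebraMap R K r' = algebraMap R K r * m)
    {r : R} (hr : r ∈ 𝔠) {m : K} (hm : m ∈ M) :
    ∃ r' ∈ 𝔠, algebraMap R K r' = algebraMap R K r * m := by
  obtain ⟨r', hr'⟩ := (h𝔠 r).mp hr m hm
  refine ⟨r', (h𝔠 r').mpr fun m' hm' => ?_, hr'⟩
  obtain ⟨r'', hr''⟩ := (h𝔠 r).mp hr (m * m') (hMmul m hm m' hm')
  exact ⟨r'', by rw [hr'', hr', mul_assoc]⟩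

/-- **The trace ideal of the conductor is the conductor**: `𝔠·𝔠⁻¹ ≤ 𝔠` in `FractionalIdeal R⁰ K`.
For `q ∈ 𝔠⁻¹` and `c ∈ 𝔠`, `qc = r₀ ∈ R` and `r₀ m = q·(cm)` with `cm ∈ 𝔠`, so `r₀ m ∈ R` for all
`m ∈ C`: `r₀ ∈ 𝔠`. [folklore] -/
theorem coe_mul_inv_le_coe (M : Submodule R K) (hMmul : ∀ a ∈ M, ∀ b ∈ M, a * b ∈ M)
    (𝔠 : Ideal R) (h𝔠 : ∀ r : R, r ∈ 𝔠 ↔ ∀ m ∈ M, ∃ r' : R, algebraMap R K r' = algebraMap R K r * m) :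
    (𝔠 : FractionalIdeal R⁰ K) * (𝔠 : FractionalIdeal R⁰ K)⁻¹ ≤ 𝔠 := by
  by_cases h0 : (𝔠 : FractionalIdeal R⁰ K) = 0
  · simp [h0]
  refine FractionalIdeal.mul_le.mpr fun i hi j hj => ?_
  obtain ⟨r, hr, rfl⟩ := (FractionalIdeal.mem_coeIdeal R⁰).mp hi
  have hj' := (FractionalIdeal.mem_inv_iff h0).mp hj
  obtain ⟨r₀, hr₀⟩ := (FractionalIdeal.mem_one_iff R⁰).mp (hj' _ hi)
  -- `r₀ ∈ 𝔠`
  have hr₀𝔠 : r₀ ∈ 𝔠 := by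
    refine (h𝔠 r₀).mpr fun m hm => ?_
    obtain ⟨r₁, hr₁𝔠, hr₁⟩ := exists_mem_conductor_eq_mul M hMmul 𝔠 h𝔠 hr hm
    obtain ⟨r', hr'⟩ := (FractionalIdeal.mem_one_iff R⁰).mp
      (hj' _ (FractionalIdeal.mem_coeIdeal_of_mem R⁰ hr₁𝔠))
    exact ⟨r', by rw [hr', hr₁, ← mul_assoc, ← hr₀]⟩
  rw [mul_comm, ← hr₀]
  exact FractionalIdeal.mem_coeIdeal_of_mem R⁰ hr₀𝔠

/-- **The conductor of a module-finite intermediate ring is nonzero**: a common denominator of the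
generators of `M` lies in `𝔠`. [folklore] -/
theorem conductor_ne_bot (M : Submodule R K) (hMfg : M.FG)
    (𝔠 : Ideal R) (h𝔠 : ∀ r : R, r ∈ 𝔠 ↔ ∀ m ∈ M, ∃ r' : R, algebraMap R K r' = algebraMap R K r * m) :
    𝔠 ≠ ⊥ := by
  classical
  obtain ⟨s, hs⟩ := hMfg
  obtain ⟨b, hb⟩ := IsLocalization.exist_integer_multiples_of_finset R⁰ s
  have hbne : (b : R) ≠ 0 := nonZeroDivisors.coe_ne_zero b
  -- the submodule of elements made integral by `b`
  let N : Submodule R K := Submodule.comap ((b : R) • (LinearMap.id : K →ₗ[R] K)) 1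
  have hsN : (s : Set K) ⊆ N := by
    intro a ha
    obtain ⟨r', hr'⟩ := RingHom.mem_rangeS.mp (hb a ha)
    change (b : R) • a ∈ (1 : Submodule R K)
    rw [Submodule.one_eq_range]
    exact ⟨r', by simpa [Algebra.linearMap_apply] using hr'⟩
  have hMN : M ≤ N := by
    rw [← hs]
    exact Submodule.span_le.mpr hsN
  have hb𝔠 : (b : R) ∈ 𝔠 := by
    refine (h𝔠 b).mpr fun m hm => ?_
    have hmN := hMN hm
    change (b : R) • m ∈ (1 : Submodule R K) at hmN
    rw [Submodule.one_eq_range] at hmN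
    obtain ⟨r', hr'⟩ := hmN
    exact ⟨r', by simpa [Algebra.linearMap_apply, Algebra.smul_def] using hr'⟩
  intro h
  rw [h] at hb𝔠
  exact hbne ((Submodule.mem_bot R).mp hb𝔠)

/-! ## Duals are second syzygies -/

/-- **Over a noetherian ring the dual `Hom_R(N, R)` of a finitely generated module is a second syzygy
module**: for a finite presentation `Rᵐ —ρ→ Rⁿ —π→ N → 0`, `N* ≅ range π* = ker ρ*`, the kernel of a map
between finitely generated free modules (tree `isSyzygy_two_ker`). [folklore] -/
theorem exists_isSyzygy_two_dual {A : Type u} [CommRing A] [IsNoetherianRing A] (N : Type u)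
    [AddCommGroup N] [Module A N] [Module.Finite A N] :
    ∃ (X : ModuleCat.{u} A), Module.Finite A X ∧ IsSyzygy 2 X (ModuleCat.of A (Module.Dual A N)) := by
  obtain ⟨n, π, hπ⟩ := Module.Finite.exists_fin' A N
  haveI : Module.Finite A (LinearMap.ker π) := Module.IsNoetherian.finite A _
  obtain ⟨m, ρ₀, hρ₀⟩ := Module.Finite.exists_fin' A (LinearMap.ker π)
  let ρ : (Fin m → A) →ₗ[A] (Fin n → A) := (LinearMap.ker π).subtype ∘ₗ ρ₀
  have hrange : LinearMap.range ρ = LinearMap.ker π := by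
    rw [LinearMap.range_comp, LinearMap.range_eq_top.mpr hρ₀, Submodule.map_top, Submodule.range_subtype]
  have hker : LinearMap.range π.dualMap = LinearMap.ker ρ.dualMap := by
    rw [LinearMap.ker_dualMap_eq_dualAnnihilator_range, hrange,
      LinearMap.range_dualMap_eq_dualAnnihilator_ker_of_surjective π hπ]
  let e : Module.Dual A N ≃ₗ[A] LinearMap.ker ρ.dualMap :=
    (LinearEquiv.ofInjective π.dualMap (LinearMap.dualMap_injective_of_surjective hπ)).trans
      (LinearEquiv.ofEq _ _ hker)
  refine ⟨ModuleCat.of A (Module.Dual A (Fin m → A) ⧸ LinearMap.range ρ.dualMap), inferInstance, ?_⟩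
  exact (isSyzygy_two_ker ρ.dualMap).of_iso e.symm.toModuleIso

/-! ## The conductor is the dual of `C` -/

/-- The key identity behind `𝔠 ≅ Hom_R(C, R)`: a linear form `ψ` on `C ∋ 1` is multiplication by
`ψ(1)` — `ψ(m) = ψ(1)·m` in `K` (clear the denominator of `m`). [folklore] -/
theorem algebraMap_dual_apply_eq (M : Submodule R K) (hM1 : (1 : K) ∈ M) (ψ : Module.Dual R ↥M)
    (m : ↥M) : algebraMap R K (ψ m) = algebraMap R K (ψ ⟨1, hM1⟩) * (m : K) := by
  obtain ⟨⟨r, d⟩, hrd⟩ := IsLocalization.surj R⁰ (m : K)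
  -- `hrd : ↑m * algebraMap R K ↑d = algebraMap R K r`
  have hdne : algebraMap R K (d : R) ≠ 0 :=
    IsFractionRing.to_map_ne_zero_of_mem_nonZeroDivisors d.2
  have hdm : (d : R) • m = r • (⟨1, hM1⟩ : ↥M) := by
    apply Subtype.ext
    change (d : R) • (m : K) = r • (1 : K)
    rw [Algebra.smul_def, Algebra.smul_def, mul_one, mul_comm, hrd]
  have h1 : (d : R) * ψ m = r * ψ ⟨1, hM1⟩ := by
    rw [← smul_eq_mul, ← smul_eq_mul, ← map_smul, ← map_smul, hdm]
  have h2 : algebraMap R K (d : R) * algebraMap R K (ψ m) =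
      algebraMap R K (d : R) * (algebraMap R K (ψ ⟨1, hM1⟩) * (m : K)) := by
    rw [← map_mul, h1, map_mul, ← hrd]
    ring
  exact mul_left_cancel₀ hdne h2

/-- **`𝔠 ≅ Hom_R(C, R)`** as `R`-modules (`c ↦ (m ↦ cm)`), for an `R`-submodule `M = C ⊆ K = Frac R`
containing `1`: existence of a linear equivalence (no definition is introduced). [folklore] -/
theorem exists_linearEquiv_conductor_dual (M : Submodule R K) (hM1 : (1 : K) ∈ M)
    (𝔠 : Ideal R) (h𝔠 : ∀ r : R, r ∈ 𝔠 ↔ ∀ m ∈ M, ∃ r' : R, algebraMap R K r' = algebraMap R K r * m) :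
    Nonempty (↥𝔠 ≃ₗ[R] Module.Dual R ↥M) := by
  classical
  have hinj : Function.Injective (algebraMap R K) := IsFractionRing.injective R K
  -- the value `cm ∈ R` of the form attached to `c ∈ 𝔠`
  have hval : ∀ (c : ↥𝔠) (m : ↥M), ∃ r' : R, algebraMap R K r' = algebraMap R K (c : R) * (m : K) :=
    fun c m => (h𝔠 c).mp c.2 m m.2
  choose v hv using hval
  have hv_add_right : ∀ (c : ↥𝔠) (m m' : ↥M), v c (m + m') = v c m + v c m' := fun c m m' =>
    hinj (by rw [map_add, hv, hv, hv, Submodule.coe_add, mul_add])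
  have hv_smul_right : ∀ (c : ↥𝔠) (r : R) (m : ↥M), v c (r • m) = r • v c m := fun c r m =>
    hinj (by rw [hv, Submodule.coe_smul, Algebra.smul_def, smul_eq_mul, map_mul, hv]; ring)
  -- the bundled map `𝔠 → Hom_R(M, R)`
  let Φ₀ : ↥𝔠 → Module.Dual R ↥M := fun c =>
    { toFun := v c
      map_add' := hv_add_right c
      map_smul' := hv_smul_right c }
  have hΦ₀ : ∀ c m, algebraMap R K (Φ₀ c m) = algebraMap R K (c : R) * (m : K) := fun c m => hv c m
  let Φ : ↥𝔠 →ₗ[R] Module.Dual R ↥M :=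
    { toFun := Φ₀
      map_add' := fun c c' => by
        ext m
        apply hinj
        rw [LinearMap.add_apply, map_add, hΦ₀, hΦ₀, hΦ₀, Submodule.coe_add, map_add, add_mul]
      map_smul' := fun r c => by
        ext m
        apply hinj
        rw [RingHom.id_apply, LinearMap.smul_apply, smul_eq_mul, map_mul, hΦ₀, hΦ₀, Submodule.coe_smul,
          smul_eq_mul, map_mul, mul_assoc] }
  refine ⟨LinearEquiv.ofBijective Φ ⟨?_, ?_⟩⟩
  · -- injective: evaluate at `1`
    intro c c' h
    have h1 := congrArg (fun ψ : Module.Dual R ↥M => algebraMap R K (ψ ⟨1, hM1⟩)) h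
    change algebraMap R K (Φ₀ c ⟨1, hM1⟩) = algebraMap R K (Φ₀ c' ⟨1, hM1⟩) at h1
    rw [hΦ₀, hΦ₀, mul_one, mul_one] at h1
    exact Subtype.ext (hinj h1)
  · -- surjective: `ψ = Φ (ψ 1)`
    intro ψ
    have hψ : ∀ m : ↥M, algebraMap R K (ψ m) = algebraMap R K (ψ ⟨1, hM1⟩) * (m : K) :=
      algebraMap_dual_apply_eq M hM1 ψ
    have hc : ψ ⟨1, hM1⟩ ∈ 𝔠 := (h𝔠 _).mpr fun m hm => ⟨ψ ⟨m, hm⟩, hψ ⟨m, hm⟩⟩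
    refine ⟨⟨ψ ⟨1, hM1⟩, hc⟩, ?_⟩
    ext m
    apply hinj
    change algebraMap R K (Φ₀ ⟨ψ ⟨1, hM1⟩, hc⟩ m) = _
    rw [hΦ₀, hψ m]

/-- **The conductor is a second syzygy module** (as the dual of the finitely generated module `C`).
[folklore] -/
theorem exists_isSyzygy_two_conductor [IsNoetherianRing R] (M : Submodule R K) (hM1 : (1 : K) ∈ M)
    (hMfg : M.FG) (𝔠 : Ideal R)
    (h𝔠 : ∀ r : R, r ∈ 𝔠 ↔ ∀ m ∈ M, ∃ r' : R, algebraMap R K r' = algebraMap R K r * m) :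
    ∃ (X : ModuleCat.{u} R), Module.Finite R X ∧ IsSyzygy 2 X (ModuleCat.of R ↥𝔠) := by
  haveI : Module.Finite R ↥M := Module.Finite.iff_fg.mpr hMfg
  obtain ⟨e⟩ := exists_linearEquiv_conductor_dual M hM1 𝔠 h𝔠
  obtain ⟨X, hX, h2⟩ := exists_isSyzygy_two_dual (A := R) ↥M
  exact ⟨X, hX, h2.of_iso e.symm.toModuleIso⟩

/-! ## The ceiling -/

/-- **`caˢ⁺¹(R) ⊆ 𝔠` whenever the conductor is an `s`-th syzygy**: an element of `caˢ⁺¹(R)` lies in the trace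
ideal `𝔠·𝔠⁻¹` (tree `mem_mul_inv_of_mem_cohomologyAnnihilatorOfDegree_of_isSyzygy`), which is `⊆ 𝔠`
(`coe_mul_inv_le_coe`). [folklore] -/
theorem mem_conductor_of_mem_cohomologyAnnihilatorOfDegree_of_isSyzygy [IsNoetherianRing R]
    (M : Submodule R K) (hMmul : ∀ a ∈ M, ∀ b ∈ M, a * b ∈ M) (hMfg : M.FG) (𝔠 : Ideal R)
    (h𝔠 : ∀ r : R, r ∈ 𝔠 ↔ ∀ m ∈ M, ∃ r' : R, algebraMap R K r' = algebraMap R K r * m)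
    {s : ℕ} {x : R} (hx : x ∈ cohomologyAnnihilatorOfDegree R (s + 1))
    {X : ModuleCat.{u} R} [Module.Finite R X] (hsyz : IsSyzygy s X (ModuleCat.of R ↥𝔠)) : x ∈ 𝔠 := by
  have h0 : 𝔠 ≠ ⊥ := conductor_ne_bot M hMfg 𝔠 h𝔠
  have hmem := mem_mul_inv_of_mem_cohomologyAnnihilatorOfDegree_of_isSyzygy (K := K) 𝔠 h0 hx hsyz
  have hmem' := coe_mul_inv_le_coe M hMmul 𝔠 h𝔠 hmem
  obtain ⟨r, hr, hrx⟩ := (FractionalIdeal.mem_coeIdeal R⁰).mp hmem'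
  rwa [← IsFractionRing.injective R K hrx]

/-- **THE CONDUCTOR CEILING `ca³(R) ⊆ 𝔠`.** For a noetherian domain `R` with fraction field `K` and a
module-finite intermediate ring `R ⊆ C ⊆ K` (an `R`-submodule `M ∋ 1` of `K`, closed under multiplication,
finitely generated) with conductor `𝔠 = {r | rC ⊆ R}`: every element of `ca³(R)` (Iyengar–Takahashi's
cohomology annihilator of degree `3`) lies in `𝔠`. [folklore] -/
theorem cohomologyAnnihilatorOfDegree_three_le_conductor [IsNoetherianRing R] (M : Submodule R K)
    (hM1 : (1 : K) ∈ M) (hMmul : ∀ a ∈ M, ∀ b ∈ M, a * b ∈ M) (hMfg : M.FG) (𝔠 : Ideal R)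
    (h𝔠 : ∀ r : R, r ∈ 𝔠 ↔ ∀ m ∈ M, ∃ r' : R, algebraMap R K r' = algebraMap R K r * m) :
    cohomologyAnnihilatorOfDegree R 3 ≤ 𝔠 := by
  intro x hx
  obtain ⟨X, hX, hsyz⟩ := exists_isSyzygy_two_conductor M hM1 hMfg 𝔠 h𝔠
  haveI := hX
  exact mem_conductor_of_mem_cohomologyAnnihilatorOfDegree_of_isSyzygy M hMmul hMfg 𝔠 h𝔠 (s := 2) hx hsyz

/-- **Level-free form under a syzygy hypothesis**: if the conductor is an `s`-th syzygy for all large `s`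
(e.g. `R` Gorenstein of dimension `≤ 2`, where `𝔠 = Hom_R(C,R)` is maximal Cohen–Macaulay), then the whole
cohomology annihilator `ca(R) = ⋃ₛ caˢ(R)` lies in `𝔠`. [folklore] -/
theorem cohomologyAnnihilator_le_conductor_of_forall_isSyzygy [IsNoetherianRing R] (M : Submodule R K)
    (hMmul : ∀ a ∈ M, ∀ b ∈ M, a * b ∈ M) (hMfg : M.FG) (𝔠 : Ideal R)
    (h𝔠 : ∀ r : R, r ∈ 𝔠 ↔ ∀ m ∈ M, ∃ r' : R, algebraMap R K r' = algebraMap R K r * m)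
    (hsyz : ∃ s₀ : ℕ, ∀ s : ℕ, s₀ ≤ s →
      ∃ (X : ModuleCat.{u} R), Module.Finite R X ∧ IsSyzygy s X (ModuleCat.of R ↥𝔠)) :
    cohomologyAnnihilator R ≤ 𝔠 := by
  intro x hx
  obtain ⟨n, hn⟩ := mem_cohomologyAnnihilator_iff.mp hx
  obtain ⟨s₀, hs₀⟩ := hsyz
  obtain ⟨X, hX, hs⟩ := hs₀ (max s₀ n) (le_max_left _ _)
  haveI := hX
  exact mem_conductor_of_mem_cohomologyAnnihilatorOfDegree_of_isSyzygy M hMmul hMfg 𝔠 h𝔠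
    (cohomologyAnnihilatorOfDegree_mono (by omega) hn) hs

/-! ## The route's vocabulary: subalgebras of a field -/

/-- **Conductor ceiling for subalgebras** `B ≤ C` of a field `K` with `Frac B = K` and `C` contained in a
finitely generated `B`-submodule of itself (module-finite over `B`): every `x ∈ ca³(B)` multiplies `C` into
`B`.  (The non-normal stage `0` of the canonical tower and its normalisation are the case in point.)
[folklore] -/
theorem Subalgebra.coe_mul_mem_of_mem_cohomologyAnnihilatorOfDegree_three {k : Type u} [Field k]
    [Algebra k K] (B C : Subalgebra k K) (hBC : B ≤ C) [IsFractionRing ↥B K] [IsNoetherianRing ↥B]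
    (hfin : ∃ s : Finset K, (↑s : Set K) ⊆ (C : Set K) ∧ (C : Set K) ⊆ Submodule.span ↥B (↑s : Set K))
    {x : ↥B} (hx : x ∈ cohomologyAnnihilatorOfDegree ↥B 3) {γ : K} (hγ : γ ∈ C) :
    (x : K) * γ ∈ B := by
  classical
  -- `C` as a `B`-submodule of `K`
  let M : Submodule ↥B K := Submodule.span ↥B (C : Set K)
  have hCM : ∀ {y : K}, y ∈ M ↔ y ∈ C := by
    intro y
    constructor
    · intro hy
      refine Submodule.span_induction (p := fun y _ => y ∈ C) (fun z hz => hz) C.zero_mem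
        (fun a b _ _ ha hb => C.add_mem ha hb) (fun b a _ ha => ?_) hy
      rw [Algebra.smul_def]
      exact C.mul_mem (hBC b.2) ha
    · exact fun hy => Submodule.subset_span hy
  have hM1 : (1 : K) ∈ M := hCM.mpr C.one_mem
  have hMmul : ∀ a ∈ M, ∀ b ∈ M, a * b ∈ M := fun a ha b hb =>
    hCM.mpr (C.mul_mem (hCM.mp ha) (hCM.mp hb))
  have hMfg : M.FG := by
    obtain ⟨s, hsC, hCs⟩ := hfin
    refine ⟨s, le_antisymm (Submodule.span_mono hsC) ?_⟩
    exact Submodule.span_le.mpr hCs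
  -- the conductor ideal
  let 𝔠 : Ideal ↥B :=
    { carrier := {r | ∀ m ∈ M, ∃ r' : ↥B, algebraMap (↥B) K r' = algebraMap (↥B) K r * m}
      add_mem' := fun {a b} ha hb m hm => by
        obtain ⟨a', ha'⟩ := ha m hm
        obtain ⟨b', hb'⟩ := hb m hm
        exact ⟨a' + b', by rw [map_add, ha', hb', map_add, add_mul]⟩
      zero_mem' := fun m _ => ⟨0, by simp⟩
      smul_mem' := fun c {a} ha m hm => by
        obtain ⟨a', ha'⟩ := ha m hm
        exact ⟨c * a', by rw [map_mul, ha', smul_eq_mul, map_mul, mul_assoc]⟩ }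
  have h𝔠 : ∀ r : ↥B, r ∈ 𝔠 ↔ ∀ m ∈ M, ∃ r' : ↥B, algebraMap (↥B) K r' = algebraMap (↥B) K r * m :=
    fun r => Iff.rfl
  have hx𝔠 : x ∈ 𝔠 := cohomologyAnnihilatorOfDegree_three_le_conductor M hM1 hMmul hMfg 𝔠 h𝔠 hx
  obtain ⟨r', hr'⟩ := (h𝔠 x).mp hx𝔠 γ (hCM.mpr hγ)
  change (r' : K) = (x : K) * γ at hr'
  rw [← hr']
  exact r'.2


/-! ## Appendix (same seat, later the same day): reflexive modules are second syzygies; the reflexive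
rank-one ceiling `ca³(R) ⊆ 𝔞·𝔞⁻¹` -/

/-- **A finitely generated REFLEXIVE module over a noetherian ring is a second syzygy module**
(`N ≅ N** = (N*)*` is the dual of the finitely generated module `N*`; `exists_isSyzygy_two_dual`).  The
converse (second syzygies over a domain are reflexive) is the tree's `isReflexive_of_isSyzygy_two` (W4.4 CA0).
[folklore] -/
theorem exists_isSyzygy_two_of_isReflexive {A : Type u} [CommRing A] [IsNoetherianRing A] (N : Type u)
    [AddCommGroup N] [Module A N] [Module.Finite A N] [Module.IsReflexive A N] :
    ∃ (X : ModuleCat.{u} A), Module.Finite A X ∧ IsSyzygy 2 X (ModuleCat.of A N) := by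
  -- `N*` is finitely generated: it embeds in `(Aⁿ)*`
  obtain ⟨n, π, hπ⟩ := Module.Finite.exists_fin' A N
  haveI : Module.Finite A (Module.Dual A N) :=
    Module.Finite.of_injective π.dualMap (LinearMap.dualMap_injective_of_surjective hπ)
  obtain ⟨X, hX, h2⟩ := exists_isSyzygy_two_dual (A := A) (Module.Dual A N)
  exact ⟨X, hX, h2.of_iso (Module.evalEquiv A N).symm.toModuleIso⟩

/-- **The reflexive rank-one ceiling at the surface level**: over a noetherian domain, an element of `ca³(R)`
lies in the trace ideal `𝔞·𝔞⁻¹` of every nonzero REFLEXIVE ideal `𝔞` (e.g. every divisorial ideal of a normal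
domain) — tree `PersistenceTraceCriterion.mem_mul_inv_of_mem_cohomologyAnnihilatorOfDegree_of_isSyzygy`
(res-L1-w44b-stub-2) at `s = 2` with `exists_isSyzygy_two_of_isReflexive`.  This is the level-`3` form of the
chain's rank-one CEILINGS `ca(T) ⊆ ⋂_D I_D·I_D⁻¹`. [cite: IyengarTakahashi2014, Remark 2.13] -/
theorem algebraMap_mem_mul_inv_of_isReflexive [IsNoetherianRing R] (I : Ideal R) (hI : I ≠ ⊥)
    [Module.IsReflexive R ↥I] {x : R} (hx : x ∈ cohomologyAnnihilatorOfDegree R 3) :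
    algebraMap R K x ∈ (I : FractionalIdeal R⁰ K) * (I : FractionalIdeal R⁰ K)⁻¹ := by
  obtain ⟨X, hX, h2⟩ := exists_isSyzygy_two_of_isReflexive (A := R) ↥I
  haveI := hX
  exact mem_mul_inv_of_mem_cohomologyAnnihilatorOfDegree_of_isSyzygy (K := K) I hI (s := 2) hx h2

end Summit.ResolutionOfSingularities.ResolutionOfSingularities.Theorems.HomologicalConductor.PersistenceConductorCeiling

end
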